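import Summits.AtomisticToContinuum.FouriersLaw.Theorems.OddSectorIrreversibilityOddDensityIsCorrectorIdentificationKey
import Summits.AtomisticToContinuum.FouriersLaw.Theorems.OddSectorIrreversibilityOddDensityIsCorrectorAbelLimit

/-!
# `OddDensityIsCorrector`, part 12: identification of the weak solution, `h = μ_T(h) + (R₀ g)∘Θ`

Helper file for support item `stmt-AtomisticToContinuum-9146`
(`OddSectorIrreversibility.OddDensityIsCorrector`).

**Identification theorem** (`pinnedChain_response_identification`): for the pinned anharmonic chain at
equilibrium, if `h ∈ L²(μ_T)` satisfies the weak adjoint equation `∫ (LF) h dμ_T = -∫ F g dμ_T` for all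
test functions `F`, with a source `g` that is nice, centred (`μ_T(g) = 0`) and even in the momenta,
then

  `h = μ_T(h) + (R₀ g)∘Θ`   `μ_T`-a.e.,   `R₀ g(z) = ∫₀^∞ P_t g(z) dt`

(formally `h = (∫₀^∞ P_t* g dt)` up to the constant, with `P_t* = Θ P_t Θ`). Proof: approximate `h` in
`L²(μ_T)` by a compactly supported continuous `h₁` (`MemLp.exists_hasCompactSupport_integral_rpow_sub_le`);
the key estimate (`pinnedChain_key_estimate`) bounds `h - (R_λ g + λR_λ(h₁∘Θ))∘Θ` by `√8 ‖h - h₁‖`; the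
Abel limits `R_λ g → R₀ g`, `λR_λ(h₁∘Θ) → μ_T(h₁)` (`AbelLimit`) and `(μ_T(h₁) - μ_T(h))² ≤ ‖h₁ - h‖²`
make `‖h - μ_T(h) - (R₀g)∘Θ‖²` smaller than any `η > 0`. Nothing here closes an item.
-/

noncomputable section

open MeasureTheory ProbabilityTheory Filter Topology Set Function
open scoped ContDiff NNReal ENNReal
open Literature.MathematicalPhysics.KineticTheory.HeatConduction
open Summit.AtomisticToContinuum.FouriersLaw.Theorems.SubdiffusiveBondHeat

namespace Summit.AtomisticToContinuum.FouriersLaw.Theorems.OddSectorIrreversibility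

variable {N : ℕ}

/-- Jensen for the square on a probability space: `(∫ u)² ≤ ∫ u²` (`0 ≤ ∫ (u - ∫u)²`). [folklore] -/
theorem sq_integral_le_integral_sq {μ : Measure (PhaseSpace N)} [IsProbabilityMeasure μ] {u : PhaseSpace N → ℝ}
    (hu : Integrable u μ) (hu2 : Integrable (fun z => u z ^ 2) μ) :
    (∫ z, u z ∂μ) ^ 2 ≤ ∫ z, u z ^ 2 ∂μ := by
  set m := ∫ z, u z ∂μ with hm
  have h0 : 0 ≤ ∫ z, (u z - m) ^ 2 ∂μ := integral_nonneg fun z => sq_nonneg _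
  have e : ∫ z, (u z - m) ^ 2 ∂μ = (∫ z, u z ^ 2 ∂μ) - m ^ 2 := by
    have hsplit : (fun z => (u z - m) ^ 2) = fun z => u z ^ 2 - (2 * m) * u z + m ^ 2 := by funext z; ring
    have i1 : Integrable (fun z => u z ^ 2 - (2 * m) * u z) μ := hu2.sub (hu.const_mul _)
    rw [hsplit, integral_add i1 (integrable_const _), integral_sub hu2 (hu.const_mul _), integral_const_mul, integral_const]
    simp only [probReal_univ, smul_eq_mul, one_mul]
    rw [← hm]; ring
  linarith

/-- `(a + b + c + d)² ≤ 4 (a² + b² + c² + d²)`. [folklore] -/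
theorem sq_add_four_le (a b c d : ℝ) : (a + b + c + d) ^ 2 ≤ 4 * (a ^ 2 + b ^ 2 + c ^ 2 + d ^ 2) := by
  nlinarith [sq_nonneg (a - b), sq_nonneg (a - c), sq_nonneg (a - d), sq_nonneg (b - c), sq_nonneg (b - d), sq_nonneg (c - d)]

section Pinned

variable {ω₂ lam β γ : ℝ} (hω : 0 < ω₂) (hl : 0 ≤ lam) (hβ : 0 < β) (hγ : 0 < γ) (hN : 2 ≤ N)
  {T : ℝ} (hT : 0 < T)
include hω hl hβ hγ hN hT

set_option maxHeartbeats 400000 in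
/-- **Identification of the response density.** For the pinned anharmonic chain at equilibrium
(`0 < ϑ`, `2ϑ < 1/T`): if `h ∈ L²(μ_T)` (measurable) satisfies `∫ (LF) h dμ_T = -∫ F g dμ_T` for
every test function `F`, where `g` is continuous with `|g| ≤ C e^{ϑH}`, even in the momenta and
centred, then `h = μ_T(h) + (R₀ g)∘Θ` a.e., `R₀ g(z) = ∫_{(0,∞)} P_t g(z) dt`.
[cite: KunduDharNarayan2009, eq. (reln2)] [cite: MaesNetocny2010, Thm 3.1] -/
theorem pinnedChain_response_identification {ϑ : ℝ} (hϑ0 : 0 < ϑ) (h2ϑ : 2 * ϑ < 1 / T)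
    {h : PhaseSpace N → ℝ} (hhm : Measurable h) (hh : MemLp h 2 ((pinnedChain ω₂ lam β γ).gibbsMeasure N T))
    {g : PhaseSpace N → ℝ} (hg : Continuous g) {Cg : ℝ} (hCg : 0 ≤ Cg)
    (hgb : ∀ y, |g y| ≤ Cg * Real.exp (ϑ * (pinnedChain ω₂ lam β γ).hamiltonian N y))
    (hge : ∀ y : PhaseSpace N, g (y.1, -y.2) = g y)
    (hg0 : ∫ y, g y ∂((pinnedChain ω₂ lam β γ).gibbsMeasure N T) = 0)
    (hweak : ∀ F : PhaseSpace N → ℝ, ContDiff ℝ ∞ F → HasCompactSupport F →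
      ∫ x, (pinnedChain ω₂ lam β γ).generator N T T F x * h x ∂((pinnedChain ω₂ lam β γ).gibbsMeasure N T) =
        -∫ x, F x * g x ∂((pinnedChain ω₂ lam β γ).gibbsMeasure N T)) :
    ∀ᵐ z ∂((pinnedChain ω₂ lam β γ).gibbsMeasure N T),
      h z = (∫ x, h x ∂((pinnedChain ω₂ lam β γ).gibbsMeasure N T)) +
        ∫ t in Ioi (0 : ℝ), ∫ y, g y ∂((pinnedChain ω₂ lam β γ).transitionKernel N T T t.toNNReal (z.1, -z.2)) := by
  set P := pinnedChain ω₂ lam β γ with hP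
  set π := P.gibbsMeasure N T with hπ
  have hN0 : 0 < N := by omega
  have hϑ1 : ϑ < 1 / T := by linarith
  haveI : IsProbabilityMeasure π := pinnedChain_isProbabilityMeasure_gibbsMeasure hω hl hβ.le γ N hT
  have hΘm : Measurable (fun y : PhaseSpace N => ((y.1, -y.2) : PhaseSpace N)) := measurable_fst.prodMk measurable_snd.neg
  have hmp := measurePreserving_reversal_gibbsMeasure P N T
  have hHΘ : ∀ y : PhaseSpace N, P.hamiltonian N (y.1, -y.2) = P.hamiltonian N y :=
    fun y => OscillatorChain.hamiltonian_neg_momentum P N y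
  obtain ⟨K, c, hK, hc, hb⟩ := pinnedChain_harris_bound hω hl hβ hγ hN0 hT hϑ0 hϑ1
  have hE2 : Integrable (fun z => Real.exp (2 * ϑ * P.hamiltonian N z)) π :=
    pinnedChain_integrable_exp_mul_hamiltonian_gibbsMeasure hω hl hβ.le γ N hT h2ϑ
  set E₂ := ∫ z, Real.exp (2 * ϑ * P.hamiltonian N z) ∂π with hE₂
  have hE₂0 : 0 ≤ E₂ := integral_nonneg fun z => (Real.exp_pos _).le
  have hexpsq : ∀ z, Real.exp (ϑ * P.hamiltonian N z) ^ 2 = Real.exp (2 * ϑ * P.hamiltonian N z) := fun z => by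
    rw [← Real.exp_nat_mul]; ring_nf
  -- the Kubo integral `R₀ g` and the candidate `Q = m + (R₀ g)∘Θ`
  obtain ⟨R0, hR0⟩ : ∃ R0 : PhaseSpace N → ℝ, R0 = fun z => ∫ t in Ioi (0 : ℝ),
    ∫ y, g y ∂(P.transitionKernel N T T t.toNNReal z) := ⟨_, rfl⟩
  have hR0m : Measurable R0 := by
    rw [hR0]; exact (pinnedChain_stronglyMeasurable_kubo hω hl hβ.le hγ.le T T hg.measurable).measurable
  have hR0b : ∀ z, |R0 z| ≤ K * Cg * Real.exp (ϑ * P.hamiltonian N z) / c := fun z => by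
    rw [hR0]; exact pinnedChain_abs_kubo_le hω hl hβ hγ hb hc hg hCg hgb hg0 z
  set m := ∫ x, h x ∂π with hm
  obtain ⟨Q, hQ⟩ : ∃ Q : PhaseSpace N → ℝ, Q = fun z => m + R0 (z.1, -z.2) := ⟨_, rfl⟩
  have hQm : Measurable Q := by rw [hQ]; exact measurable_const.add (hR0m.comp hΘm)
  have hh2 : Integrable (fun z => h z ^ 2) π := hh.integrable_sq
  have hR0Θ2 : Integrable (fun z : PhaseSpace N => R0 (z.1, -z.2) ^ 2) π := by
    refine Integrable.mono' (hE2.const_mul ((K * Cg / c) ^ 2)) ((hR0m.comp hΘm).pow_const 2).aestronglyMeasurable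
      (Eventually.of_forall fun z => ?_)
    rw [Real.norm_eq_abs, abs_pow, ← hexpsq, ← hHΘ z]
    have := hR0b (z.1, -z.2)
    calc |R0 (z.1, -z.2)| ^ 2 ≤ (K * Cg * Real.exp (ϑ * P.hamiltonian N (z.1, -z.2)) / c) ^ 2 :=
          pow_le_pow_left₀ (abs_nonneg _) this 2
      _ = (K * Cg / c) ^ 2 * Real.exp (ϑ * P.hamiltonian N (z.1, -z.2)) ^ 2 := by ring
  have hQ2 : Integrable (fun z => Q z ^ 2) π :=
    (((integrable_const (m ^ 2)).add hR0Θ2).const_mul 2).mono' (hQm.pow_const 2).aestronglyMeasurable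
      (Eventually.of_forall fun z => by
        rw [Real.norm_eq_abs, abs_of_nonneg (sq_nonneg _), Pi.add_apply, hQ]
        nlinarith [sq_nonneg (m - R0 (z.1, -z.2))])
  have hhQ2 : Integrable (fun z => (h z - Q z) ^ 2) π :=
    ((hh2.add hQ2).const_mul 2).mono' ((hhm.sub hQm).pow_const 2).aestronglyMeasurable
      (Eventually.of_forall fun z => by
        rw [Real.norm_eq_abs, abs_of_nonneg (sq_nonneg _), Pi.add_apply]; nlinarith [sq_nonneg (h z + Q z)])
  -- MAIN CLAIM: `∫ (h - Q)² ≤ η` for every `η > 0`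
  have hmain : ∀ η : ℝ, 0 < η → ∫ z, (h z - Q z) ^ 2 ∂π ≤ η := by
    intro η hη
    -- (i) an approximant `h₁ ∈ C_c` with `∫ (h - h₁)² ≤ ε`, `ε = η/72`
    set ε := η / 72 with hε
    have hε0 : 0 < ε := by positivity
    have hh' : MemLp h (ENNReal.ofReal 2) π := by simpa using hh
    obtain ⟨h₁, hh₁s, hh₁app, hh₁c, -⟩ := hh'.exists_hasCompactSupport_integral_rpow_sub_le two_pos hε0
    have he : ∫ z, (h z - h₁ z) ^ 2 ∂π ≤ ε := by
      have : ∫ z, (h z - h₁ z) ^ 2 ∂π = ∫ z, ‖h z - h₁ z‖ ^ (2 : ℝ) ∂π :=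
        integral_congr_ae (Eventually.of_forall fun z => by dsimp only; rw [Real.rpow_two, Real.norm_eq_abs, sq_abs])
      rw [this]; exact hh₁app
    obtain ⟨B₁, hB₁⟩ := hh₁c.bounded_above_of_compact_support hh₁s
    have hB₁0 : 0 ≤ B₁ := (norm_nonneg _).trans (hB₁ 0)
    have hh₁2 : Integrable (fun z => h₁ z ^ 2) π := integrable_sq_of_bounded hh₁c hB₁
    have hE2' : Integrable (fun z => (h z - h₁ z) ^ 2) π :=
      ((hh2.add hh₁2).const_mul 2).mono' ((hhm.sub hh₁c.measurable).pow_const 2).aestronglyMeasurable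
        (Eventually.of_forall fun z => by
          rw [Real.norm_eq_abs, abs_of_nonneg (sq_nonneg _), Pi.add_apply]; nlinarith [sq_nonneg (h z + h₁ z)])
    -- (ii) the choice of `λ`
    set S : ℝ := ((K * Cg / c ^ 2) ^ 2 + (K * B₁ / c) ^ 2) * E₂ with hS
    have hS0 : 0 ≤ S := by positivity
    set lam' : ℝ := min 1 (η / (8 * (S + 1))) with hlam'
    have hlam : 0 < lam' := lt_min one_pos (by positivity)
    have hlam1 : lam' ≤ 1 := min_le_left _ _
    have hlam2 : lam' ≤ η / (8 * (S + 1)) := min_le_right _ _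
    have hlamS : 4 * (lam' ^ 2 * S) ≤ η / 2 := by
      have h1 : lam' ^ 2 * S ≤ lam' * S := by
        have : lam' ^ 2 ≤ lam' := by nlinarith
        exact mul_le_mul_of_nonneg_right this hS0
      have h2 : lam' * S ≤ η / (8 * (S + 1)) * S := mul_le_mul_of_nonneg_right hlam2 hS0
      have h3 : η / (8 * (S + 1)) * S ≤ η / (8 * (S + 1)) * (S + 1) :=
        mul_le_mul_of_nonneg_left (by linarith) (by positivity)
      have h4 : η / (8 * (S + 1)) * (S + 1) = η / 8 := by field_simp
      linarith
    -- (iii) the resolvent pieces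
    obtain ⟨Rg, hRg⟩ : ∃ Rg : PhaseSpace N → ℝ, Rg = fun z => ∫ t in Ioi (0 : ℝ), Real.exp (-(lam' * t)) *
      ∫ y, g y ∂(P.transitionKernel N T T t.toNNReal z) := ⟨_, rfl⟩
    set h₁Θ : PhaseSpace N → ℝ := fun y => h₁ (y.1, -y.2) with hh₁Θ
    have hh₁Θc : Continuous h₁Θ := hh₁c.comp (continuous_fst.prodMk continuous_snd.neg)
    have hh₁Θb : ∀ y, |h₁Θ y| ≤ B₁ * Real.exp (ϑ * P.hamiltonian N y) := fun y =>
      abs_le_exp_bound_of_bounded hω.le hl hβ.le γ hϑ0.le (fun y => hB₁ (y.1, -y.2)) y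
    obtain ⟨Rh, hRh⟩ : ∃ Rh : PhaseSpace N → ℝ, Rh = fun z => ∫ t in Ioi (0 : ℝ), Real.exp (-(lam' * t)) *
      ∫ y, h₁Θ y ∂(P.transitionKernel N T T t.toNNReal z) := ⟨_, rfl⟩
    have hRgm : Measurable Rg := by
      rw [hRg]; exact (pinnedChain_stronglyMeasurable_resolvent hω hl hβ.le hγ.le T T hg.measurable lam').measurable
    have hRhm : Measurable Rh := by
      rw [hRh]; exact (pinnedChain_stronglyMeasurable_resolvent hω hl hβ.le hγ.le T T hh₁Θc.measurable lam').measurable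
    -- key estimate: `∫ D² ≤ 8 e`, `D = h - (Rg + λ Rh)∘Θ`
    obtain ⟨D, hD⟩ : ∃ D : PhaseSpace N → ℝ, D = fun z => h z - (Rg (z.1, -z.2) + lam' * Rh (z.1, -z.2)) := ⟨_, rfl⟩
    have hkey : ∫ z, D z ^ 2 ∂π ≤ 8 * ∫ z, (h z - h₁ z) ^ 2 ∂π := by
      have hk := pinnedChain_key_estimate hω hl hβ hγ hN hT hϑ0 h2ϑ hhm hh hg hCg hgb hge hweak hh₁c hB₁ hlam
      have e : (fun z => D z ^ 2) = fun z => (h z - ((∫ t in Ioi (0 : ℝ), Real.exp (-(lam' * t)) *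
          ∫ y, g y ∂(P.transitionKernel N T T t.toNNReal (z.1, -z.2))) +
          lam' * ∫ t in Ioi (0 : ℝ), Real.exp (-(lam' * t)) *
          ∫ y, h₁ (y.1, -y.2) ∂(P.transitionKernel N T T t.toNNReal (z.1, -z.2)))) ^ 2 := by
        funext z; rw [hD, hRg, hRh]
      rw [e]; exact hk
    -- pointwise bounds: `|Rg - R0| ≤ λ A E`, `|λ Rh - π(h₁)| ≤ λ B E`
    have hπh₁ : ∫ z, h₁Θ z ∂π = ∫ z, h₁ z ∂π := integral_comp_reversal_gibbsMeasure P N T h₁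
    have hRgR0 : ∀ z, |Rg z - R0 z| ≤ lam' * (K * Cg * Real.exp (ϑ * P.hamiltonian N z)) / c ^ 2 := fun z => by
      rw [hRg, hR0]; exact pinnedChain_abs_resolvent_sub_kubo_le hω hl hβ hγ hϑ0 hb hc hg hCg hgb hg0 hlam z
    have hRhm1 : ∀ z, |lam' * Rh z - ∫ x, h₁ x ∂π| ≤ lam' * (K * B₁ * Real.exp (ϑ * P.hamiltonian N z)) / c := fun z => by
      rw [hRh, ← hπh₁]; exact pinnedChain_abs_abelMean_sub_le hω hl hβ hγ hϑ0 hb hc hh₁Θc hB₁0 hh₁Θb hlam z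
    -- the decomposition `h - Q = D + (Rg - R0)∘Θ + ((λRh)∘Θ - πh₁) + (πh₁ - m)`
    have hdec : ∀ z, h z - Q z = D z + (Rg (z.1, -z.2) - R0 (z.1, -z.2)) +
        (lam' * Rh (z.1, -z.2) - ∫ x, h₁ x ∂π) + ((∫ x, h₁ x ∂π) - m) := fun z => by
      rw [hQ, hD]; ring
    -- integrate the four squares
    have hDm' : Measurable D := by rw [hD]; exact hhm.sub ((hRgm.comp hΘm).add ((hRhm.comp hΘm).const_mul _))
    have i2 : Integrable (fun z : PhaseSpace N => (Rg (z.1, -z.2) - R0 (z.1, -z.2)) ^ 2) π := by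
      refine Integrable.mono' (hE2.const_mul ((lam' * (K * Cg) / c ^ 2) ^ 2))
        (((hRgm.comp hΘm).sub (hR0m.comp hΘm)).pow_const 2).aestronglyMeasurable (Eventually.of_forall fun z => ?_)
      rw [Real.norm_eq_abs, abs_pow, ← hexpsq, ← hHΘ z]
      calc |Rg (z.1, -z.2) - R0 (z.1, -z.2)| ^ 2 ≤ (lam' * (K * Cg * Real.exp (ϑ * P.hamiltonian N (z.1, -z.2))) / c ^ 2) ^ 2 :=
            pow_le_pow_left₀ (abs_nonneg _) (hRgR0 _) 2
        _ = (lam' * (K * Cg) / c ^ 2) ^ 2 * Real.exp (ϑ * P.hamiltonian N (z.1, -z.2)) ^ 2 := by ring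
    have i3 : Integrable (fun z : PhaseSpace N => (lam' * Rh (z.1, -z.2) - ∫ x, h₁ x ∂π) ^ 2) π := by
      refine Integrable.mono' (hE2.const_mul ((lam' * (K * B₁) / c) ^ 2))
        ((((hRhm.comp hΘm).const_mul _).sub measurable_const).pow_const 2).aestronglyMeasurable
        (Eventually.of_forall fun z => ?_)
      rw [Real.norm_eq_abs, abs_pow, ← hexpsq, ← hHΘ z]
      calc |lam' * Rh (z.1, -z.2) - ∫ x, h₁ x ∂π| ^ 2 ≤ (lam' * (K * B₁ * Real.exp (ϑ * P.hamiltonian N (z.1, -z.2))) / c) ^ 2 :=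
            pow_le_pow_left₀ (abs_nonneg _) (hRhm1 _) 2
        _ = (lam' * (K * B₁) / c) ^ 2 * Real.exp (ϑ * P.hamiltonian N (z.1, -z.2)) ^ 2 := by ring
    have iD : Integrable (fun z => D z ^ 2) π := by
      -- `D² ≤ 4((h-Q)² + ...)` from the decomposition read backwards
      refine (((hhQ2.add i2).add (i3.add (integrable_const (((∫ x, h₁ x ∂π) - m) ^ 2)))).const_mul 4).mono'
        (hDm'.pow_const 2).aestronglyMeasurable (Eventually.of_forall fun z => ?_)
      rw [Real.norm_eq_abs, abs_of_nonneg (sq_nonneg _)]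
      simp only [Pi.add_apply]
      have := sq_add_four_le (h z - Q z) (-(Rg (z.1, -z.2) - R0 (z.1, -z.2)))
        (-(lam' * Rh (z.1, -z.2) - ∫ x, h₁ x ∂π)) (-((∫ x, h₁ x ∂π) - m))
      have e : h z - Q z + -(Rg (z.1, -z.2) - R0 (z.1, -z.2)) + -(lam' * Rh (z.1, -z.2) - ∫ x, h₁ x ∂π) +
          -((∫ x, h₁ x ∂π) - m) = D z := by rw [hdec z]; ring
      rw [e] at this
      nlinarith [this]
    have hbound : ∫ z, (h z - Q z) ^ 2 ∂π ≤ 4 * ((∫ z, D z ^ 2 ∂π) + (∫ z, (Rg (z.1, -z.2) - R0 (z.1, -z.2)) ^ 2 ∂π) +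
        (∫ z, (lam' * Rh (z.1, -z.2) - ∫ x, h₁ x ∂π) ^ 2 ∂π) + ((∫ x, h₁ x ∂π) - m) ^ 2) := by
      have hpt : ∀ z, (h z - Q z) ^ 2 ≤ 4 * (D z ^ 2 + (Rg (z.1, -z.2) - R0 (z.1, -z.2)) ^ 2 +
          (lam' * Rh (z.1, -z.2) - ∫ x, h₁ x ∂π) ^ 2 + ((∫ x, h₁ x ∂π) - m) ^ 2) := fun z => by
        rw [hdec z]; exact sq_add_four_le _ _ _ _
      have iR : Integrable (fun z => 4 * (D z ^ 2 + (Rg (z.1, -z.2) - R0 (z.1, -z.2)) ^ 2 +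
          (lam' * Rh (z.1, -z.2) - ∫ x, h₁ x ∂π) ^ 2 + ((∫ x, h₁ x ∂π) - m) ^ 2)) π :=
        (((iD.add i2).add i3).add (integrable_const _)).const_mul 4 |>.congr (Eventually.of_forall fun z => rfl)
      calc ∫ z, (h z - Q z) ^ 2 ∂π ≤ ∫ z, 4 * (D z ^ 2 + (Rg (z.1, -z.2) - R0 (z.1, -z.2)) ^ 2 +
            (lam' * Rh (z.1, -z.2) - ∫ x, h₁ x ∂π) ^ 2 + ((∫ x, h₁ x ∂π) - m) ^ 2) ∂π := integral_mono hhQ2 iR hpt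
        _ = _ := by
          have iAB : Integrable (fun z => D z ^ 2 + (Rg (z.1, -z.2) - R0 (z.1, -z.2)) ^ 2) π := iD.add i2
          have iABC : Integrable (fun z => D z ^ 2 + (Rg (z.1, -z.2) - R0 (z.1, -z.2)) ^ 2 +
              (lam' * Rh (z.1, -z.2) - ∫ x, h₁ x ∂π) ^ 2) π := iAB.add i3
          rw [integral_const_mul, integral_add iABC (integrable_const _), integral_add iAB i3, integral_add iD i2,
            integral_const]
          simp only [probReal_univ, smul_eq_mul, one_mul]
    -- the four bounds
    have b1 : ∫ z, D z ^ 2 ∂π ≤ 8 * ε := hkey.trans (by nlinarith)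
    have b2 : ∫ z, (Rg (z.1, -z.2) - R0 (z.1, -z.2)) ^ 2 ∂π ≤ lam' ^ 2 * ((K * Cg / c ^ 2) ^ 2 * E₂) := by
      have hΘi := integral_comp_reversal_gibbsMeasure P N T (fun z => (Rg z - R0 z) ^ 2)
      rw [hΘi]
      have hpt : ∀ z, (Rg z - R0 z) ^ 2 ≤ (lam' * (K * Cg) / c ^ 2) ^ 2 * Real.exp (2 * ϑ * P.hamiltonian N z) := fun z => by
        rw [← hexpsq]
        calc (Rg z - R0 z) ^ 2 = |Rg z - R0 z| ^ 2 := (sq_abs _).symm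
          _ ≤ (lam' * (K * Cg * Real.exp (ϑ * P.hamiltonian N z)) / c ^ 2) ^ 2 := pow_le_pow_left₀ (abs_nonneg _) (hRgR0 z) 2
          _ = _ := by ring
      calc ∫ z, (Rg z - R0 z) ^ 2 ∂π ≤ ∫ z, (lam' * (K * Cg) / c ^ 2) ^ 2 * Real.exp (2 * ϑ * P.hamiltonian N z) ∂π :=
            integral_mono ((hmp.integrable_comp_emb (momentumReversal N).measurableEmbedding).1
              (by simpa [Function.comp_def, momentumReversal_apply] using i2)) (hE2.const_mul _) hpt
        _ = lam' ^ 2 * ((K * Cg / c ^ 2) ^ 2 * E₂) := by rw [integral_const_mul]; ring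
    have b3 : ∫ z, (lam' * Rh (z.1, -z.2) - ∫ x, h₁ x ∂π) ^ 2 ∂π ≤ lam' ^ 2 * ((K * B₁ / c) ^ 2 * E₂) := by
      have hΘi := integral_comp_reversal_gibbsMeasure P N T (fun z => (lam' * Rh z - ∫ x, h₁ x ∂π) ^ 2)
      rw [hΘi]
      have hpt : ∀ z, (lam' * Rh z - ∫ x, h₁ x ∂π) ^ 2 ≤ (lam' * (K * B₁) / c) ^ 2 * Real.exp (2 * ϑ * P.hamiltonian N z) :=
        fun z => by
        rw [← hexpsq]
        calc (lam' * Rh z - ∫ x, h₁ x ∂π) ^ 2 = |lam' * Rh z - ∫ x, h₁ x ∂π| ^ 2 := (sq_abs _).symm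
          _ ≤ (lam' * (K * B₁ * Real.exp (ϑ * P.hamiltonian N z)) / c) ^ 2 := pow_le_pow_left₀ (abs_nonneg _) (hRhm1 z) 2
          _ = _ := by ring
      calc ∫ z, (lam' * Rh z - ∫ x, h₁ x ∂π) ^ 2 ∂π ≤ ∫ z, (lam' * (K * B₁) / c) ^ 2 * Real.exp (2 * ϑ * P.hamiltonian N z) ∂π :=
            integral_mono ((hmp.integrable_comp_emb (momentumReversal N).measurableEmbedding).1
              (by simpa [Function.comp_def, momentumReversal_apply] using i3)) (hE2.const_mul _) hpt
        _ = lam' ^ 2 * ((K * B₁ / c) ^ 2 * E₂) := by rw [integral_const_mul]; ring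
    have b4 : ((∫ x, h₁ x ∂π) - m) ^ 2 ≤ ε := by
      have hu : Integrable (fun z => h₁ z - h z) π := by
        have hh1 : Integrable h π := hh.integrable one_le_two
        have hh₁i : Integrable h₁ π := (integrable_const B₁).mono' hh₁c.aestronglyMeasurable (Eventually.of_forall hB₁)
        exact hh₁i.sub hh1
      have hu2 : Integrable (fun z => (h₁ z - h z) ^ 2) π := hE2'.congr (Eventually.of_forall fun z => by ring)
      have hJ := sq_integral_le_integral_sq hu hu2
      have e1 : ∫ z, (h₁ z - h z) ∂π = (∫ x, h₁ x ∂π) - m := by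
        rw [integral_sub ((integrable_const B₁).mono' hh₁c.aestronglyMeasurable (Eventually.of_forall hB₁)) (hh.integrable one_le_two)]
      have e2 : ∫ z, (h₁ z - h z) ^ 2 ∂π = ∫ z, (h z - h₁ z) ^ 2 ∂π := integral_congr_ae (Eventually.of_forall fun z => by ring)
      rw [e1, e2] at hJ
      exact hJ.trans he
    have hsum : lam' ^ 2 * ((K * Cg / c ^ 2) ^ 2 * E₂) + lam' ^ 2 * ((K * B₁ / c) ^ 2 * E₂) = lam' ^ 2 * S := by
      simp only [hS]; ring
    calc ∫ z, (h z - Q z) ^ 2 ∂π ≤ 4 * (8 * ε + lam' ^ 2 * ((K * Cg / c ^ 2) ^ 2 * E₂) + lam' ^ 2 * ((K * B₁ / c) ^ 2 * E₂) + ε) := by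
          linarith [hbound, b1, b2, b3, b4]
      _ = 36 * ε + 4 * (lam' ^ 2 * S) := by rw [← hsum]; ring
      _ ≤ η := by rw [hε]; linarith
  -- conclusion: `∫ (h - Q)² = 0`, so `h = Q` a.e.
  have hzero : ∫ z, (h z - Q z) ^ 2 ∂π = 0 :=
    le_antisymm (le_of_forall_pos_le_add fun η hη => by simpa using hmain η hη) (integral_nonneg fun z => sq_nonneg _)
  have hae : (fun z => (h z - Q z) ^ 2) =ᵐ[π] 0 :=
    (integral_eq_zero_iff_of_nonneg (fun z => sq_nonneg _) hhQ2).1 hzero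
  filter_upwards [hae] with z hz
  have : h z - Q z = 0 := pow_eq_zero_iff two_ne_zero |>.1 hz
  rw [sub_eq_zero] at this
  rw [this, hQ, hR0]

end Pinned

end Summit.AtomisticToContinuum.FouriersLaw.Theorems.OddSectorIrreversibility

end
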